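import Summits.Ventures.GridStability.Bench.KUNDUR2ACSGDeg4AOwnVDeg4Nu4ibk3m1PpRoa
import Summits.Ventures.GridStability.Bench.KUNDUR2ACSGDeg2AOwnVNu4ibk3m1PpRoaModel
import Summits.Ventures.GridStability.Lyapunov.ClassicalSwingForward
import Mathlib.Analysis.SpecialFunctions.Trigonometric.Deriv
import Mathlib.Tactic.IntervalCases
import HarnessLib

/-!
# #50-roa — «G2.a-K2A-alg-deg4»-roa (model half): no pole slip and return to synchronism FOR model-1's two-area
# four-machine model `Kundur2A.csgPre.toModelRel (1/10) a′` from the DEGREE-4 own-V certificate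
# `Bench/KUNDUR2ACSGDeg4AOwnVDeg4Nu4ibk3m1Pp` (level 3/28)

Venture GRIDFUSION, cell `gridfusion`, `plan/PARTITION.md` A2/A5/A6; lead g6 RULING 7t (1)(C) 2026-08-27T13:17:55Z (#50-roa);
seat gridfusion-lyap-2 (g3). Sibling of `KUNDUR2ACSGDeg4AOwnVDeg4Nu4ibk3m1PpRoa.lean` (recast half, `…_roa`), which it
imports. BRIDGE PATTERN of #62 (`WSCC9Deg4ASosgramDinstRoaModel.lean`): it is the SAME MODEL, the SAME instance
`Kundur2A.csgPre : RecastData 3` (`Models/Kundur2A.lean`, model-1 p466090 / p473726) and the SAME exact relative embedding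
as #22's file-of-record companion `KUNDUR2ACSGDeg2AOwnVNu4ibk3m1PpRoaModel.lean` (gridfusion-lyap-1 p508277), so — instead
of restating them — this file IMPORTS that companion and REUSES its vocabulary VERBATIM (`deg2_A_ownV_nu4ibk3m1_pp_Z`,
`…_Z_eq_k`, `…_vars_Z`, `…_relField_eval_k` (faithfulness: component `k` of the TREE OBJECT `Kundur2A.csgPre.relField (1/10)`
and the Bench literal have the same `Poly.norm`, one `decide` each, proved THERE), `…_hasDerivWithinAt_Z`, `…_Z_mem_M`);
the only new facts are that the two Bench files carry the same recast field and the same constraint set (`…_F_eq_F` —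
by `simp` on the emitted `_eq` lemmas, the deg-4 emission listing the speed components in graded term order — and
`…_M_eq_M`), and the model-level reading of the degree-4 certificate's sublevel piece (`…_model_roa`,
`…_model_roa_wellPosed` via lyap-1's `ClassicalSwing.existsUnique_and_forall` p520190 on lyap-2 g0's global
well-posedness `Models/ClassicalSwingGlobal` p518035).

THREE COLUMNS. CERTIFIED: the six Bench identities of the degree-4 file (consumed only through
`deg4_A_ownV_deg4_nu4ibk3m1_pp_roa`). MODELLED: every theorem here is about model-1's classical model
`Kundur2A.csgPre.toModelRel (1/10) a′` (`ClassicalSwing 4`: Chow–Sanchez-Gasca two-area four-machine data, Kron-reduced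
with constant-impedance loads, transfer conductances kept, K rounded h12, scaled time `τ = t/√(2H/Ω)` with unit inertias,
ASSUMED UNIFORM DAMPING RATIO `λ = 1/10` — census label «synthetic uniform damping on the printed two-area network», never
a sentence about the printed `D = 0` system — and an ARBITRARY common acceleration `a′ ∈ ℝ`, which cancels in every
relative quantity; equilibrium relative angles `θ⋆ = Kundur2A.csgPre.angleOf` (exact circle points); MODEL-VALIDITY token
= model-2's KUNDUR2A-CSG block + MV-λ(1/10)). VALIDATED: nothing. No sentence of this file says a grid is stable; «return
to synchronism» below is a property OF THE MODEL for the stated initial data.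

STATEMENT (`deg4_A_ownV_deg4_nu4ibk3m1_pp_model_roa`): for every `a′`, every `0 < γ ≤ 3/28` and every solution `c` of the
model on `[0, ∞)` whose relative recast initial state `Z (c 0)` satisfies `V ≤ γ` (degree-4 `V`) and whose initial
relative angle deviations satisfy `|u_i(0)| < π` (`i = 1, 2, 3`): `V(Z (c t)) ≤ γ` for all `t ≥ 0`; no relative angle
deviation ever reaches `±π` (no pole slip); every `u_i(t) → 0`; every relative speed `ω_i(t) − ω_0(t) → 0`;
`…_model_roa_wellPosed`: the same with «there is exactly one solution on `ℝ` from every such machine state».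
-/

namespace Summit.Ventures.GridStability.Bench.KUNDUR2ACSG

open Set Filter Metric Topology Real
open Summit.Ventures.GridStability.Lyapunov Summit.Ventures.GridStability.Models
open Literature.Computation.Certificates Literature.Computation.Certificates.SOS

noncomputable section

/-! ### The deg-4 certificate rides on the SAME recast field / constraints / embedding as #22's deg-2 companion -/

/-- The two Bench certificates of the instance carry the SAME recast field (both = model-1's
`Kundur2A.csgPre.relField (1/10)` verbatim, interface I2; the deg-4 emission lists the 15-term speed components in
graded term order; `simp` normalises both): `deg4_A_ownV_deg4_nu4ibk3m1_pp_F = deg2_A_ownV_nu4ibk3m1_pp_F`. [folklore] -/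
theorem deg4_A_ownV_deg4_nu4ibk3m1_pp_F_eq_F : deg4_A_ownV_deg4_nu4ibk3m1_pp_F = deg2_A_ownV_nu4ibk3m1_pp_F := by
  funext z i
  fin_cases i <;>
    simp [deg4_A_ownV_deg4_nu4ibk3m1_pp_F, deg2_A_ownV_nu4ibk3m1_pp_F,
      deg4_A_ownV_deg4_nu4ibk3m1_pp_f_sigma_2_eq, deg4_A_ownV_deg4_nu4ibk3m1_pp_f_kappa_2_eq,
      deg4_A_ownV_deg4_nu4ibk3m1_pp_f_sigma_11_eq, deg4_A_ownV_deg4_nu4ibk3m1_pp_f_kappa_11_eq,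
      deg4_A_ownV_deg4_nu4ibk3m1_pp_f_sigma_12_eq, deg4_A_ownV_deg4_nu4ibk3m1_pp_f_kappa_12_eq,
      deg4_A_ownV_deg4_nu4ibk3m1_pp_f_nu_2_eq, deg4_A_ownV_deg4_nu4ibk3m1_pp_f_nu_11_eq,
      deg4_A_ownV_deg4_nu4ibk3m1_pp_f_nu_12_eq,
      deg2_A_ownV_nu4ibk3m1_pp_f_sigma_2_eq, deg2_A_ownV_nu4ibk3m1_pp_f_kappa_2_eq,
      deg2_A_ownV_nu4ibk3m1_pp_f_sigma_11_eq, deg2_A_ownV_nu4ibk3m1_pp_f_kappa_11_eq,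
      deg2_A_ownV_nu4ibk3m1_pp_f_sigma_12_eq, deg2_A_ownV_nu4ibk3m1_pp_f_kappa_12_eq,
      deg2_A_ownV_nu4ibk3m1_pp_f_nu_2_eq, deg2_A_ownV_nu4ibk3m1_pp_f_nu_11_eq,
      deg2_A_ownV_nu4ibk3m1_pp_f_nu_12_eq]

/-- … and the SAME constraint set `{h₁ = h₂ = h₃ = 0}`:
`deg4_A_ownV_deg4_nu4ibk3m1_pp_M = deg2_A_ownV_nu4ibk3m1_pp_M`. [folklore] -/
theorem deg4_A_ownV_deg4_nu4ibk3m1_pp_M_eq_M : deg4_A_ownV_deg4_nu4ibk3m1_pp_M = deg2_A_ownV_nu4ibk3m1_pp_M := by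
  ext z
  simp only [deg4_A_ownV_deg4_nu4ibk3m1_pp_M, deg2_A_ownV_nu4ibk3m1_pp_M, mem_setOf_eq,
    deg4_A_ownV_deg4_nu4ibk3m1_pp_h1_eq, deg4_A_ownV_deg4_nu4ibk3m1_pp_h2_eq, deg4_A_ownV_deg4_nu4ibk3m1_pp_h3_eq,
    deg2_A_ownV_nu4ibk3m1_pp_h1_eq, deg2_A_ownV_nu4ibk3m1_pp_h2_eq, deg2_A_ownV_nu4ibk3m1_pp_h3_eq]

/-- **Exact embedding along solutions of the model** for THIS Bench field: along every solution `c` of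
`Kundur2A.csgPre.toModelRel (1/10) a′` on `s`, the relative recast curve `t ↦ Z (c t)` (#22's
`deg2_A_ownV_nu4ibk3m1_pp_Z` = model-1's `RecastData.embedRel θ⋆`) solves `ż = F(z)` with
`deg4_A_ownV_deg4_nu4ibk3m1_pp_F` — from the companion's `deg2_A_ownV_nu4ibk3m1_pp_hasDerivWithinAt_Z` (faithfulness
`relField_eval_k` proved there by `decide` on `Poly.norm`) and `…_F_eq_F`. [folklore] -/
theorem deg4_A_ownV_deg4_nu4ibk3m1_pp_hasDerivWithinAt_Z (a : ℝ) {c : ℝ → ClassicalSwing.State 4} {s : Set ℝ}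
    (hc : (Kundur2A.csgPre.toModelRel (1 / 10) a).IsSolutionOn c s) {t : ℝ} (ht : t ∈ s) :
    HasDerivWithinAt (fun τ ↦ deg2_A_ownV_nu4ibk3m1_pp_Z (c τ))
      (deg4_A_ownV_deg4_nu4ibk3m1_pp_F (deg2_A_ownV_nu4ibk3m1_pp_Z (c t))) s t := by
  rw [deg4_A_ownV_deg4_nu4ibk3m1_pp_F_eq_F]
  exact deg2_A_ownV_nu4ibk3m1_pp_hasDerivWithinAt_Z a hc ht

/-- The relative recast state of any model state lies on THIS file's constraint set `M`. [folklore] -/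
theorem deg4_A_ownV_deg4_nu4ibk3m1_pp_Z_mem_M (x : ClassicalSwing.State 4) :
    deg2_A_ownV_nu4ibk3m1_pp_Z x ∈ deg4_A_ownV_deg4_nu4ibk3m1_pp_M := by
  rw [deg4_A_ownV_deg4_nu4ibk3m1_pp_M_eq_M]
  exact deg2_A_ownV_nu4ibk3m1_pp_Z_mem_M x

/-! ### The ROA sentence in machine coordinates -/

/-- **#50-roa in original coordinates (two-area four-machine model, uniform damping ratio `1/10`, any common
acceleration `a′`), with angle recovery (A6).** See the module docstring for the three columns. For every
`0 < γ ≤ 3/28` and every solution `c` on `[0, ∞)` with `V(Z (c 0)) ≤ γ` and `|u_i(0)| < π`: the certified piece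
of the DEGREE-4 certificate is never left, no relative rotor angle deviation reaches `±π`, `u_i(t) → 0` and
`ω_i(t) − ω_0(t) → 0` (`i = 1, 2, 3`). [folklore] -/
theorem deg4_A_ownV_deg4_nu4ibk3m1_pp_model_roa (a : ℝ) {γ : ℝ} (hγ0 : 0 < γ) (hγ : γ ≤ deg4_A_ownV_deg4_nu4ibk3m1_pp_level)
    {c : ℝ → ClassicalSwing.State 4} (hc : (Kundur2A.csgPre.toModelRel (1 / 10) a).IsSolutionOn c (Ici 0))
    (h0V : deg4_A_ownV_deg4_nu4ibk3m1_pp_Vz (deg2_A_ownV_nu4ibk3m1_pp_Z (c 0)) ≤ γ)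
    (h0win : ∀ i : Fin 3, |RecastData.u Kundur2A.csgPre.angleOf (c 0) i.succ| < π) :
    (∀ t, 0 ≤ t → deg4_A_ownV_deg4_nu4ibk3m1_pp_Vz (deg2_A_ownV_nu4ibk3m1_pp_Z (c t)) ≤ γ) ∧
    (∀ i : Fin 3, ∀ t, 0 ≤ t → |RecastData.u Kundur2A.csgPre.angleOf (c t) i.succ| < π) ∧
    (∀ i : Fin 3, Tendsto (fun t ↦ RecastData.u Kundur2A.csgPre.angleOf (c t) i.succ) atTop (𝓝 0)) ∧
    (∀ i : Fin 3, Tendsto (fun t ↦ (c t).2 i.succ - (c t).2 0) atTop (𝓝 0)) := by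
  -- continuity of the solution and of the relative angle deviations on `[0, ∞)`
  have hcc : ContinuousOn c (Ici 0) := fun t ht ↦ (hc t ht).continuousWithinAt
  have h1c : ∀ j, ContinuousOn (fun τ ↦ (c τ).1 j) (Ici 0) := fun j ↦
    ((continuous_apply j).comp continuous_fst).comp_continuousOn hcc
  have hu : ∀ i : Fin 3, ContinuousOn (fun t ↦ RecastData.u Kundur2A.csgPre.angleOf (c t) i.succ) (Ici 0) := by
    intro i
    simp only [RecastData.u]
    exact ((h1c _).sub (h1c 0)).sub continuousOn_const
  set z : ℝ → Fin 9 → ℝ := fun τ ↦ deg2_A_ownV_nu4ibk3m1_pp_Z (c τ) with hzdef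
  have hzc : ContinuousOn z (Ici 0) := by
    refine continuousOn_pi.2 fun k t ht ↦ ?_
    exact (Kundur2A.hasDerivWithinAt_embedRel (1 / 10) a hc ht k).continuousWithinAt
  have hz : ∀ t, 0 ≤ t → HasDerivWithinAt z (deg4_A_ownV_deg4_nu4ibk3m1_pp_F (z t)) (Ici t) t := fun t ht ↦
    (deg4_A_ownV_deg4_nu4ibk3m1_pp_hasDerivWithinAt_Z a hc ht).mono (Ici_subset_Ici.2 ht)
  obtain ⟨hinv, hlim⟩ := deg4_A_ownV_deg4_nu4ibk3m1_pp_roa hγ0 hγ hzc hz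
    (deg4_A_ownV_deg4_nu4ibk3m1_pp_Z_mem_M (c 0)) h0V
  have hall := tendsto_pi_nhds.1 hlim
  -- no pole slip: `κ_i ≤ 1 < 2` gives `cos u_i ≥ 0 > -1`
  have hcos : ∀ i : Fin 3, ∀ t, 0 ≤ t → -1 < cos (RecastData.u Kundur2A.csgPre.angleOf (c t) i.succ) := by
    intro i t ht
    obtain ⟨-, hk1, hk2, hk3⟩ := hinv t ht
    fin_cases i
    · simp only [hzdef, deg2_A_ownV_nu4ibk3m1_pp_Z_eq_1] at hk1
      show -1 < cos (RecastData.u Kundur2A.csgPre.angleOf (c t) 1)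
      linarith
    · simp only [hzdef, deg2_A_ownV_nu4ibk3m1_pp_Z_eq_3] at hk2
      show -1 < cos (RecastData.u Kundur2A.csgPre.angleOf (c t) 2)
      linarith
    · simp only [hzdef, deg2_A_ownV_nu4ibk3m1_pp_Z_eq_5] at hk3
      show -1 < cos (RecastData.u Kundur2A.csgPre.angleOf (c t) 3)
      linarith
  have hwin : ∀ i : Fin 3, ∀ t, 0 ≤ t → |RecastData.u Kundur2A.csgPre.angleOf (c t) i.succ| < π := fun i ↦
    abs_lt_pi_of_neg_one_lt_cos (hu i) (h0win i) (hcos i)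
  refine ⟨fun t ht ↦ (hinv t ht).1, hwin, fun i ↦ ?_, fun i ↦ ?_⟩
  · fin_cases i
    · have h := hall 1
      simp only [hzdef, deg2_A_ownV_nu4ibk3m1_pp_Z_eq_1] at h
      exact tendsto_zero_of_one_sub_cos_tendsto (hwin 0) h
    · have h := hall 3
      simp only [hzdef, deg2_A_ownV_nu4ibk3m1_pp_Z_eq_3] at h
      exact tendsto_zero_of_one_sub_cos_tendsto (hwin 1) h
    · have h := hall 5
      simp only [hzdef, deg2_A_ownV_nu4ibk3m1_pp_Z_eq_5] at h
      exact tendsto_zero_of_one_sub_cos_tendsto (hwin 2) h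
  · fin_cases i
    · have h := hall 6
      simp only [hzdef, deg2_A_ownV_nu4ibk3m1_pp_Z_eq_6, Pi.zero_apply] at h
      simpa using h
    · have h := hall 7
      simp only [hzdef, deg2_A_ownV_nu4ibk3m1_pp_Z_eq_7, Pi.zero_apply] at h
      simpa using h
    · have h := hall 8
      simp only [hzdef, deg2_A_ownV_nu4ibk3m1_pp_Z_eq_8, Pi.zero_apply] at h
      simpa using h

/-- **#50-roa, well-posed form (∃!).** For every common acceleration `a′`, every `0 < γ ≤ 3/28` and every MACHINE
STATE `x₀` of M′ with `V(Z x₀) ≤ γ` (degree-4 `V`) and `|u_i(x₀)| < π` (`i = 1, 2, 3`): (i) there is EXACTLY ONE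
solution of `Kundur2A.csgPre.toModelRel (1/10) a′` on all of `ℝ` with `c 0 = x₀` (lyap-2 g0
`Models/ClassicalSwingGlobal` p518035 / lyap-1 `ClassicalSwing.existsUnique_and_forall` p520190), and (ii) every such
solution keeps `V(Z (c t)) ≤ γ` for all `t ≥ 0`, never pole-slips, and has `u_i(t) → 0`, `ω_i(t) − ω_0(t) → 0`.
The sentence's only hypothesis is the initial machine state. MODELLED/CERTIFIED columns as in the module
docstring. [folklore] -/
theorem deg4_A_ownV_deg4_nu4ibk3m1_pp_model_roa_wellPosed (a : ℝ) {γ : ℝ} (hγ0 : 0 < γ)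
    (hγ : γ ≤ deg4_A_ownV_deg4_nu4ibk3m1_pp_level) {x₀ : ClassicalSwing.State 4}
    (hV : deg4_A_ownV_deg4_nu4ibk3m1_pp_Vz (deg2_A_ownV_nu4ibk3m1_pp_Z x₀) ≤ γ)
    (hwin : ∀ i : Fin 3, |RecastData.u Kundur2A.csgPre.angleOf x₀ i.succ| < π) :
    (∃! c : ℝ → ClassicalSwing.State 4, c 0 = x₀ ∧ (Kundur2A.csgPre.toModelRel (1 / 10) a).IsSolutionOn c univ) ∧
    ∀ c : ℝ → ClassicalSwing.State 4, c 0 = x₀ → (Kundur2A.csgPre.toModelRel (1 / 10) a).IsSolutionOn c univ →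
      (∀ t, 0 ≤ t → deg4_A_ownV_deg4_nu4ibk3m1_pp_Vz (deg2_A_ownV_nu4ibk3m1_pp_Z (c t)) ≤ γ) ∧
      (∀ i : Fin 3, ∀ t, 0 ≤ t → |RecastData.u Kundur2A.csgPre.angleOf (c t) i.succ| < π) ∧
      (∀ i : Fin 3, Tendsto (fun t ↦ RecastData.u Kundur2A.csgPre.angleOf (c t) i.succ) atTop (𝓝 0)) ∧
      (∀ i : Fin 3, Tendsto (fun t ↦ (c t).2 i.succ - (c t).2 0) atTop (𝓝 0)) :=
  ClassicalSwing.existsUnique_and_forall (Kundur2A.csgPre.toModelRel (1 / 10) a)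
    (I := fun x ↦ deg4_A_ownV_deg4_nu4ibk3m1_pp_Vz (deg2_A_ownV_nu4ibk3m1_pp_Z x) ≤ γ ∧
      ∀ i : Fin 3, |RecastData.u Kundur2A.csgPre.angleOf x i.succ| < π)
    (fun _ hc hI ↦ deg4_A_ownV_deg4_nu4ibk3m1_pp_model_roa a hγ0 hγ (hc.mono (subset_univ _)) hI.1 hI.2) ⟨hV, hwin⟩

end

end Summit.Ventures.GridStability.Bench.KUNDUR2ACSG
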